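import Summits.ValiantsHypothesis.ValiantsHypothesis.Theorems.BarrierLeverSigmaLambdaSigmaSliceCertificate
import Literature.Computability.AlgebraicComplexity.GKKSDepthFourProofs

/-!
# Route BarrierLever — the MODEL axis of crux `DefinableEquations` (stmt-ValiantsHypothesis-8745) /
# item `SingleSizeEquations` (8749): the crux's quantifier shape `∃ a ∀ b` on the HOMOGENEOUS
# depth-3 (`ΣΠΣ`) slice — part 1/2: graded partial derivatives of products of linear forms, the
# certificate, and its vanishing

The crux asks for ONE level `a` such that for EVERY size exponent `b`, eventually in `n`, a
nonzero level-`a` boolean sum in the `N = C(2n,n)` coefficient variables vanishes on the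
coefficient vectors of a class of `n`-variate polynomials of degree `≤ n` (there: `SmallCircuits ℂ n b`;
open, Chatterjee–Tengse 2023 §1.3 dir. 2).  The sibling files `…SigmaLambdaSigmaSlice*` prove that
sentence for sums of powers of affine forms (diagonal depth 3).  This file and its sequel prove it
for the class `sigmaPiSigmaSlice n (n^b)` of sums of at most `n^b` PRODUCTS of (at most `n`) LINEAR
forms — homogeneous depth-3 circuits of top fan-in `n^b` (Nisan–Wigderson 1996, §3 and §5.1) — again
at ONE level (`a = 18`, `q = 0`), and in fact for every top fan-in `s` with
`s · C(2k,k) < C(n,k)`, `k = ⌊n/9⌋` (so up to `s < 2^{⌊n/9⌋}`).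

Certificate (`spsCert n`): the determinant of the `C(n,k) × C(n,k)` matrix indexed by the
`k`-subsets `S, T` of the variables, entry `w(S,T) · c_{x^S x^T}` (`w(S,T) = 2^{|S ∩ T|}`), i.e. the
order-`k` partial-derivative matrix `(coeff_{x^T} ∂^S f)_{S,T}` with columns restricted to the
square-free monomials of degree EXACTLY `k`: it only sees the degree-`2k` homogeneous component.
VANISHING (`eval_spsCert_eq_zero`): for `f = Σ_i c_i ∏_{j<d_i} ℓ_{ij}` (`ℓ_{ij}` linear) the row of
`S` is the degree-`k` square-free coefficient vector of `x^S ⌟ f = Σ_i c_i x^S ⌟ P_i`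
(`coeff_apolarAction_monomial_one`); `x^S ⌟ P_i` is homogeneous of degree `d_i - k`
(`apolarAction_isHomogeneous`), so it contributes nothing unless `d_i = 2k`, and then it lies in the
span of the `C(2k,k)` sub-products `∏_{j ∈ J} ℓ_{ij}`, `|J| = k` (`apolarAction_sqfree_mem_prodSpan`:
the graded spans `prodSpan a m r` of `r`-fold sub-products are mapped `r+1 ↦ r` by every `∂_μ`);
hence all rows lie in a space of dimension `≤ s · C(2k,k) < C(n,k)` and the determinant vanishes
(`det_eq_zero_of_rows_mem_submodule`).  Part 2 (`…SigmaPiSigmaSliceEquations`): non-vanishing at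
`e_k(x_1²,…,x_n²)`, constructivity (level 18), thresholds, headline.
WHAT THIS IS NOT: nothing on general circuits (the crux, CT23 dir. 2), on NON-homogeneous `ΣΠΣ`
(products of affine forms: Ben-Or's interpolation defeats the measure), on formulas beyond `n²/20`,
8746, 14610 or VP vs VNP; classical mathematics (Nisan–Wigderson 1996; Sylvester's catalecticants)
made FSV-natural and kernel-checked.
-/

-- layout Summits/ValiantsHypothesis/ValiantsHypothesis forces the duplicated namespace component
set_option linter.dupNamespace false

noncomputable section

open MvPolynomial Finsupp

namespace Summit.ValiantsHypothesis.ValiantsHypothesis.Theorems.BarrierLever.SigmaPiSigmaSlice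

open Literature.Computability.AlgebraicComplexity Literature.Barriers.ValiantsHypothesis
open SigmaLambdaSigmaSlice (coeff_apolarAction_monomial_one det_eq_zero_of_rows_mem_submodule
  degree_sqfree)

/-! ## Linear forms and the graded spans of sub-products (Nisan–Wigderson 1996, §3) -/

section linear

variable {n : ℕ}

/-- The linear form `Σ_μ a_μ x_μ` with coefficient vector `a`. [folklore] -/
def linForm (a : Fin n → ℂ) : MvPolynomial (Fin n) ℂ := ∑ μ : Fin n, C (a μ) * X μ

/-- `∂_μ (Σ_ν a_ν x_ν) = a_μ`. [folklore] -/
theorem pderiv_linForm (a : Fin n → ℂ) (μ : Fin n) : pderiv μ (linForm a) = C (a μ) := by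
  classical
  rw [linForm, map_sum, Finset.sum_eq_single μ]
  · rw [pderiv_C_mul, pderiv_X_self, mul_one]
  · intro ν _ hne
    rw [pderiv_C_mul, pderiv_X_of_ne hne, mul_zero]
  · intro h
    exact absurd (Finset.mem_univ μ) h

/-- A linear form is homogeneous of degree `1`. [folklore] -/
theorem isHomogeneous_linForm (a : Fin n → ℂ) : (linForm a).IsHomogeneous 1 :=
  IsHomogeneous.sum _ _ _ fun _ _ => isHomogeneous_C_mul_X _ _

/-- Leibniz: `∂_μ ∏_{j ∈ J} ℓ_j = Σ_{j ∈ J} (ℓ_j)_μ • ∏_{j' ∈ J ∖ j} ℓ_{j'}` for linear forms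
`ℓ_j = Σ_ν a_{jν} x_ν`. [cite: NisanWigderson1996, §3 (Proposition 1)] -/
theorem pderiv_prod_linForm (a : ℕ → Fin n → ℂ) (J : Finset ℕ) (μ : Fin n) :
    pderiv μ (∏ j ∈ J, linForm (a j)) = ∑ j ∈ J, a j μ • ∏ j' ∈ J.erase j, linForm (a j') := by
  classical
  rw [GKKS.pderiv_finset_prod]
  refine Finset.sum_congr rfl fun j _ => ?_
  rw [pderiv_linForm, mul_comm, ← smul_eq_C_mul]

/-- **The graded span of sub-products**: `prodSpan a m r` is the span of the products
`∏_{j ∈ J} ℓ_j` over the `r`-subsets `J ⊆ {0,…,m-1}`, `ℓ_j = Σ_ν a_{jν} x_ν` (for a product gate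
`∏_{j<m} ℓ_j`, its partial derivatives of order `m - r` lie here).
[cite: NisanWigderson1996, §3 (Lemma 3)] -/
def prodSpan (a : ℕ → Fin n → ℂ) (m r : ℕ) : Submodule ℂ (MvPolynomial (Fin n) ℂ) :=
  Submodule.span ℂ (Set.range fun J : (Finset.range m).powersetCard r =>
    ∏ j ∈ (J : Finset ℕ), linForm (a j))

/-- The full product `∏_{j<m} ℓ_j` lies in `prodSpan a m m`. [folklore] -/
theorem prod_mem_prodSpan (a : ℕ → Fin n → ℂ) (m : ℕ) :
    (∏ j ∈ Finset.range m, linForm (a j)) ∈ prodSpan a m m :=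
  Submodule.subset_span ⟨⟨Finset.range m,
    Finset.mem_powersetCard.mpr ⟨subset_rfl, Finset.card_range m⟩⟩, rfl⟩

/-- Every first partial maps `prodSpan a m (r+1)` into `prodSpan a m r`.
[cite: NisanWigderson1996, §3 (Lemma 3)] -/
theorem pderiv_mem_prodSpan (a : ℕ → Fin n → ℂ) (m r : ℕ) (μ : Fin n)
    {g : MvPolynomial (Fin n) ℂ} (hg : g ∈ prodSpan a m (r + 1)) :
    pderiv μ g ∈ prodSpan a m r := by
  classical
  induction hg using Submodule.span_induction with
  | mem x hx =>
    obtain ⟨J, rfl⟩ := hx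
    have hJ := Finset.mem_powersetCard.mp J.2
    show pderiv μ (∏ j ∈ (J : Finset ℕ), linForm (a j)) ∈ prodSpan a m r
    rw [pderiv_prod_linForm]
    refine Submodule.sum_mem _ fun j hj => Submodule.smul_mem _ _ (Submodule.subset_span ?_)
    refine ⟨⟨(J : Finset ℕ).erase j, Finset.mem_powersetCard.mpr ⟨?_, ?_⟩⟩, rfl⟩
    · exact (Finset.erase_subset _ _).trans hJ.1
    · rw [Finset.card_erase_of_mem hj, hJ.2, Nat.add_sub_cancel]
  | zero => rw [map_zero]; exact Submodule.zero_mem _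
  | add x y _ _ hx hy => rw [map_add]; exact Submodule.add_mem _ hx hy
  | smul c x _ hx => rw [Derivation.map_smul]; exact Submodule.smul_mem _ _ hx

/-- `x^{S ∪ {i}} = x_i · x^S` as exponent vectors (`i ∉ S`). [folklore] -/
theorem sqfree_insert {i : Fin n} {S : Finset (Fin n)} (hi : i ∉ S) :
    sqfree (insert i S) = Finsupp.single i 1 + sqfree S := by
  rw [sqfree, sqfree, Finset.sum_insert hi]

/-- **Graded partials of products of linear forms**: the operator `x^S ⌟ ·` (`S` a set of
variables, i.e. the square-free derivative `∂^S`) maps `prodSpan a m (r + |S|)` into `prodSpan a m r`.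
[cite: NisanWigderson1996, §3 (Lemma 3)] -/
theorem apolarAction_sqfree_mem_prodSpan (a : ℕ → Fin n → ℂ) (m : ℕ) (S : Finset (Fin n)) :
    ∀ (r : ℕ) (g : MvPolynomial (Fin n) ℂ), g ∈ prodSpan a m (r + S.card) →
      apolarAction (monomial (sqfree S) 1) g ∈ prodSpan a m r := by
  classical
  induction S using Finset.induction_on with
  | empty =>
    intro r g hg
    rw [sqfree, Finset.sum_empty, monomial_zero', apolarAction_C, one_smul]
    simpa using hg
  | insert i S hi ih =>
    intro r g hg
    rw [Finset.card_insert_of_notMem hi, show r + (S.card + 1) = (r + 1) + S.card by omega] at hg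
    rw [sqfree_insert hi, show monomial (Finsupp.single i 1 + sqfree S) (1 : ℂ) =
      X i * monomial (sqfree S) 1 by rw [X, monomial_mul, one_mul], apolarAction_X_mul, apolarAction_X]
    exact pderiv_mem_prodSpan a m r i (ih (r + 1) g hg)

/-- Elements of `prodSpan a m r` are homogeneous of degree `r`. [folklore] -/
theorem isHomogeneous_of_mem_prodSpan (a : ℕ → Fin n → ℂ) (m r : ℕ)
    {g : MvPolynomial (Fin n) ℂ} (hg : g ∈ prodSpan a m r) : g.IsHomogeneous r := by
  have hle : prodSpan a m r ≤ homogeneousSubmodule (Fin n) ℂ r := by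
    refine Submodule.span_le.mpr ?_
    rintro _ ⟨J, rfl⟩
    rw [SetLike.mem_coe, mem_homogeneousSubmodule]
    have h := IsHomogeneous.prod (J : Finset ℕ) (fun j => linForm (a j)) (fun _ => 1)
      fun j _ => isHomogeneous_linForm (a j)
    rwa [Finset.sum_const, smul_eq_mul, mul_one, (Finset.mem_powersetCard.mp J.2).2] at h
  exact hle hg

end linear

/-! ## The slice and the certificate -/

section slice

variable (n : ℕ)

/-- **The homogeneous depth-3 slice** (`ΣΠΣ` of top fan-in `≤ s`, formal degree `≤ n`): sums of at
most `s` scalar multiples of products `∏_{j<d_i} ℓ_{ij}`, `d_i ≤ n`, of LINEAR forms `ℓ_{ij}` in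
`x_0,…,x_{n-1}` over `ℂ` (each product gate is homogeneous; every member has degree `≤ n`).
[cite: NisanWigderson1996, §3 and §5.1 (homogeneous depth-3 circuits)] -/
def sigmaPiSigmaSlice (s : ℕ) : Set (MvPolynomial (Fin n) ℂ) :=
  {f | ∃ (c : Fin s → ℂ) (d : Fin s → ℕ) (a : Fin s → ℕ → Fin n → ℂ), (∀ i, d i ≤ n) ∧
    f = ∑ i : Fin s, C (c i) * ∏ j ∈ Finset.range (d i), ∑ μ : Fin n, C (a i j μ) * X μ}

/-- The row/column index type: the `k`-subsets of the variables, `k = ⌊n/9⌋`. [folklore] -/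
abbrev KSub : Type := {S : Finset (Fin n) // S.card = n / 9}

/-- `deg (x^S x^T) = 2⌊n/9⌋ ≤ n` for `k`-subsets `S, T`. [folklore] -/
theorem degree_sqfree_add_sqfree_le (S T : KSub n) : (sqfree T.1 + sqfree S.1).degree ≤ n := by
  rw [map_add, degree_sqfree, degree_sqfree, T.2, S.2]
  omega

/-- The coefficient coordinate `c_{x^S x^T}`. [folklore] -/
def spsCoord (S T : KSub n) : degLEMonomials n :=
  ⟨sqfree T.1 + sqfree S.1, degree_sqfree_add_sqfree_le n S T⟩

/-- The descending-factorial weight `w(S,T) = ∏_{i ∈ S} (x^S x^T)_i^{(1)} = 2^{|S ∩ T|}` of the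
apolarity action `x^S ⌟ ·` on the coordinate `c_{x^S x^T}`. [cite: IarrobinoKanev1999, §1.1] -/
def spsWeight (S T : KSub n) : ℕ :=
  ∏ i ∈ (sqfree S.1).support, ((sqfree T.1 + sqfree S.1) i).descFactorial (sqfree S.1 i)

/-- **The order-`k` square-free catalecticant of coefficient variables** (`k = ⌊n/9⌋`): rows and
columns indexed by the `k`-subsets of the variables, entry `w(S,T) · c_{x^S x^T}` — the matrix
`(coeff_{x^T} ∂^S f)_{S,T}` of order-`k` partials against degree-`k` square-free monomials.
[cite: NisanWigderson1996, §3] -/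
def spsMatrix : Matrix (KSub n) (KSub n) (MvPolynomial (degLEMonomials n) ℂ) :=
  Matrix.of fun S T => C (spsWeight n S T : ℂ) * X (spsCoord n S T)

/-- **The certificate against the homogeneous depth-3 slice**: the determinant of the order-`k`
square-free catalecticant. [cite: NisanWigderson1996, §3 (Theorem 0)] -/
def spsCert : MvPolynomial (degLEMonomials n) ℂ := (spsMatrix n).det

/-- The explicit non-root: `e_k(x_0²,…,x_{n-1}²) = Σ_{|S| = k} x^{2S}`, `k = ⌊n/9⌋` (degree `2k ≤ n`).
[folklore] -/
def esqWitness : MvPolynomial (Fin n) ℂ :=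
  ∑ S : KSub n, monomial (sqfree S.1 + sqfree S.1) 1

variable {n}

/-- Evaluating the certificate at a point of coefficient space. [folklore] -/
theorem eval_spsCert (g : degLEMonomials n → ℂ) :
    eval g (spsCert n) =
      (Matrix.of fun S T => (spsWeight n S T : ℂ) * g (spsCoord n S T)).det := by
  rw [spsCert, RingHom.map_det]
  congr 1
  ext S T
  simp [spsMatrix]

/-! ## Vanishing on the slice -/

variable (n) in
/-- The degree-`k` square-free coefficient functional `g ↦ (g_{x^T})_{|T| = k}`. [folklore] -/
def kCoeffs : MvPolynomial (Fin n) ℂ →ₗ[ℂ] (KSub n → ℂ) where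
  toFun g := fun T => coeff (sqfree T.1) g
  map_add' g h := by funext T; simp
  map_smul' c g := by funext T; simp

/-- The functional `kCoeffs` kills forms of degree `≠ k`. [folklore] -/
theorem kCoeffs_eq_zero_of_isHomogeneous {g : MvPolynomial (Fin n) ℂ} {r : ℕ}
    (hg : g.IsHomogeneous r) (hr : r ≠ n / 9) : kCoeffs n g = 0 := by
  funext T
  show coeff (sqfree T.1) g = 0
  exact hg.coeff_eq_zero (by rw [degree_sqfree, T.2]; exact Ne.symm hr)

/-- The row of `S` in the evaluated certificate matrix is the degree-`k` square-free coefficient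
vector of `x^S ⌟ f`. [cite: IarrobinoKanev1999, §1.1] -/
theorem row_eq_kCoeffs_apolarAction (f : MvPolynomial (Fin n) ℂ) (S : KSub n) :
    (Matrix.of fun S T : KSub n => (spsWeight n S T : ℂ) *
        coeffVector (degLEMonomials n) f (spsCoord n S T)) S =
      kCoeffs n (apolarAction (monomial (sqfree S.1) 1) f) := by
  classical
  funext T
  rw [Matrix.of_apply, coeffVector_apply]
  show (spsWeight n S T : ℂ) * coeff (sqfree T.1 + sqfree S.1) f =
    coeff (sqfree T.1) (apolarAction (monomial (sqfree S.1) 1) f)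
  rw [coeff_apolarAction_monomial_one, spsWeight, Nat.cast_prod, mul_comm]

/-- **The certificate vanishes on the homogeneous depth-3 slice** (no degree restriction on the
product gates is needed): if `s · C(2k,k) < C(n,k)`, `k = ⌊n/9⌋`, then `spsCert n` vanishes at
`coeff (Σ_{i<s} c_i ∏_{j<d_i} ℓ_{ij})` for all linear forms `ℓ_{ij}`.
[cite: NisanWigderson1996, §3 (Lemma 3, Theorem 0)] -/
theorem eval_spsCert_eq_zero {s : ℕ} (c : Fin s → ℂ) (d : Fin s → ℕ) (a : Fin s → ℕ → Fin n → ℂ)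
    (hs : s * (2 * (n / 9)).choose (n / 9) < n.choose (n / 9)) :
    eval (coeffVector (degLEMonomials n)
      (∑ i : Fin s, C (c i) * ∏ j ∈ Finset.range (d i), linForm (a i j))) (spsCert n) = 0 := by
  classical
  -- the low-dimensional space containing all rows
  let pc := (Finset.range (2 * (n / 9))).powersetCard (n / 9)
  let gvec : Fin s × pc → (KSub n → ℂ) := fun p =>
    if d p.1 = 2 * (n / 9) then kCoeffs n (∏ j ∈ (p.2 : Finset ℕ), linForm (a p.1 j)) else 0
  let W : Submodule ℂ (KSub n → ℂ) := Submodule.span ℂ (Set.range gvec)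
  rw [eval_spsCert]
  refine det_eq_zero_of_rows_mem_submodule _ W ?_ fun S => ?_
  · calc Module.finrank ℂ W ≤ Fintype.card (Fin s × pc) := finrank_range_le_card gvec
      _ = s * (2 * (n / 9)).choose (n / 9) := by
          rw [Fintype.card_prod, Fintype.card_fin, Fintype.card_coe, Finset.card_powersetCard,
            Finset.card_range]
      _ < n.choose (n / 9) := hs
      _ = Fintype.card (KSub n) := by rw [Fintype.card_finset_len, Fintype.card_fin]
  · rw [row_eq_kCoeffs_apolarAction, apolarAction_sum_right, map_sum]
    refine Submodule.sum_mem _ fun i _ => ?_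
    rw [← smul_eq_C_mul, apolarAction_smul_right, map_smul]
    refine Submodule.smul_mem _ _ ?_
    have hP := prod_mem_prodSpan (a i) (d i)
    by_cases hdi : d i = 2 * (n / 9)
    · -- the product gate has degree exactly `2k`: its `k`-th partials span `≤ C(2k,k)` dimensions
      have hP' : (∏ j ∈ Finset.range (d i), linForm (a i j)) ∈
          prodSpan (a i) (d i) (n / 9 + S.1.card) := by
        rw [S.2, show n / 9 + n / 9 = d i by omega]
        exact hP
      have h1 := apolarAction_sqfree_mem_prodSpan (a i) (d i) S.1 (n / 9) _ hP'
      have h2 : (prodSpan (a i) (d i) (n / 9)).map (kCoeffs n) ≤ W := by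
        refine (Submodule.map_span_le _ _ _).mpr ?_
        rintro _ ⟨J, rfl⟩
        have hJ := Finset.mem_powersetCard.mp J.2
        refine Submodule.subset_span ⟨(i, ⟨(J : Finset ℕ), Finset.mem_powersetCard.mpr
          ⟨fun x hx => Finset.mem_range.mpr (by have := Finset.mem_range.mp (hJ.1 hx); omega),
            hJ.2⟩⟩), ?_⟩
        simp only [gvec, if_pos hdi]
      exact h2 (Submodule.mem_map_of_mem h1)
    · -- any other degree: the degree-`k` coefficients of `x^S ⌟ P_i` vanish by homogeneity
      have hhom : (apolarAction (monomial (sqfree S.1) 1)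
          (∏ j ∈ Finset.range (d i), linForm (a i j))).IsHomogeneous (d i - n / 9) :=
        apolarAction_isHomogeneous (isHomogeneous_monomial _ (by rw [degree_sqfree, S.2]))
          (isHomogeneous_of_mem_prodSpan (a i) (d i) (d i) hP)
      rw [kCoeffs_eq_zero_of_isHomogeneous hhom (by omega)]
      exact Submodule.zero_mem _

/-- Slice form of the vanishing: `spsCert n` vanishes on `sigmaPiSigmaSlice n s` whenever
`s · C(2k,k) < C(n,k)`, `k = ⌊n/9⌋`. [cite: NisanWigderson1996, §3 (Theorem 0)] -/
theorem eval_spsCert_eq_zero_of_mem {s : ℕ} (hs : s * (2 * (n / 9)).choose (n / 9) < n.choose (n / 9))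
    {f : MvPolynomial (Fin n) ℂ} (hf : f ∈ sigmaPiSigmaSlice n s) :
    eval (coeffVector (degLEMonomials n) f) (spsCert n) = 0 := by
  obtain ⟨c, d, a, -, rfl⟩ := hf
  exact eval_spsCert_eq_zero c d a hs

/-- Every member of the slice has degree `≤ n`. [folklore] -/
theorem totalDegree_le_of_mem_sigmaPiSigmaSlice {s : ℕ} {f : MvPolynomial (Fin n) ℂ}
    (hf : f ∈ sigmaPiSigmaSlice n s) : f.totalDegree ≤ n := by
  classical
  obtain ⟨c, d, a, hd, rfl⟩ := hf
  show (∑ i : Fin s, C (c i) * ∏ j ∈ Finset.range (d i), linForm (a i j)).totalDegree ≤ n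
  refine (totalDegree_finsetSum _ _).trans (Finset.sup_le fun i _ => ?_)
  refine (totalDegree_mul _ _).trans ?_
  rw [totalDegree_C, zero_add]
  refine (totalDegree_finsetProd _ _).trans ?_
  refine (Finset.sum_le_sum fun j _ => (isHomogeneous_linForm (a i j)).totalDegree_le).trans ?_
  rw [Finset.sum_const, Finset.card_range, smul_eq_mul, mul_one]
  exact hd i

end slice

end Summit.ValiantsHypothesis.ValiantsHypothesis.Theorems.BarrierLever.SigmaPiSigmaSlice

end
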